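import Literature.Topology.FourManifolds.GluckTwistExistence
import Literature.Topology.FourManifolds.LickorishTwistProfile
import Mathlib.LinearAlgebra.Matrix.Determinant.Basic
import Mathlib.LinearAlgebra.Matrix.Notation
import HarnessLib

/-!
# The shear regluing of a framed torus in `T² × ℝ²`: angle form versus rotation form

Infrastructure for the model datum of Iwase's theorem (`TorusSurgeryIwaseReduction.lean`,
`Literature.Topology.FourManifolds.iwase1988_of_model`; Z. Iwase, *Dehn-surgery along a torus
T²-knot*, Pacific J. Math. 133 (1988), Prop. 3.5, Cor. 3.8: the surgery is of type `(1, 0, ±1)`,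
multiplicity one). The fibre relation of `Literature.Topology.FourManifolds.IsTorusLinkSurgery` is
written with four real parameters `θ₁ θ₂ θ₃ t` and an integer matrix `A` acting on the angles; for
the two shear matrices of multiplicity one,

* `shearMatrixPos = (1 0 1; 0 1 0; 0 0 1)` and `shearMatrixNeg = (1 0 -1; 0 1 0; 0 0 1)`
  (`det = 1`), i.e. `(θ₁, θ₂, θ₃) ↦ (θ₁ ± θ₃, θ₂, θ₃)` — the meridian of the framed torus picks up
  `±` one copy of the first core circle (Larson, *Surgery on tori in the 4-sphere* (2018), §2:
  the surgery only depends on the image `p[m] + a[α] + b[β]` of the meridian; here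
  `(p, a, b) = (1, ±1, 0)`),

this file identifies the angle form with the **rotation form** `b.2 ≠ 0 ∧ p = T₀ (shear± b)`,
where `shearPos ((z₁, z₂), w) = ((w/‖w‖ · z₁, z₂), w)` rotates the first core circle by the unit
normal vector and `shearNeg` by its conjugate (`exists_angles_iff_shearPos`,
`exists_angles_iff_shearNeg`), for an ARBITRARY map `T₀` on the framed torus model. The model
datum is built with complex-number formulas, and these lemmas convert its exact tube relations
into the literal block of `IsTorusLinkSurgery`. Ingredients: the multiplication `circleMul` of
the unit circle `𝕊¹ ⊆ ℝ²` with `circleMul (circlePoint a) (circlePoint b) = circlePoint (a + b)`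
and `conjCircle (circlePoint a) = circlePoint (-a)` (`LickorishTwistProfile.lean`), and the polar
decomposition `w = ‖w‖ • circlePoint θ` of a non-zero vector (`unitVector`, `GluckTwist.lean`).
Everything is folklore trigonometry.

## References

* Z. Iwase, *Dehn-surgery along a torus T²-knot*, Pacific J. Math. 133 (1988), Prop. 3.5,
  Cor. 3.8. [Iwase1988]
* K. Larson, *Surgery on tori in the 4-sphere*, Math. Proc. Cambridge Philos. Soc. (2018), §2.
  [Larson2016]
-/

open scoped Manifold ContDiff Topology
open Function Set

noncomputable section

namespace Literature.Topology.FourManifolds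

/-- Polar decomposition of a non-zero vector of `ℝ²`. [folklore] -/
theorem exists_eq_smul_circlePoint {w : EuclideanSpace ℝ (Fin 2)} (hw : w ≠ 0) :
    ∃ θ : ℝ, unitVector w hw = circlePoint θ ∧
      w = ‖w‖ • ((circlePoint θ : Metric.sphere (0 : EuclideanSpace ℝ (Fin 2)) 1) :
        EuclideanSpace ℝ (Fin 2)) := by
  obtain ⟨θ, hθ⟩ := circlePoint_surjective (unitVector w hw)
  refine ⟨θ, hθ.symm, ?_⟩
  rw [hθ, coe_unitVector, smul_smul, mul_inv_cancel₀ (norm_ne_zero_iff.2 hw), one_smul]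

section Shear

/-- Local notation: `S¹` is the unit circle in `EuclideanSpace ℝ (Fin 2)`. -/
local notation "S¹" => (Metric.sphere (0 : EuclideanSpace ℝ (Fin 2)) 1)

/-- Local notation: `TT` is the framed torus model `(S¹ × S¹) × ℝ²`. -/
local notation "TT" => ((Metric.sphere (0 : EuclideanSpace ℝ (Fin 2)) 1 ×
  Metric.sphere (0 : EuclideanSpace ℝ (Fin 2)) 1) × EuclideanSpace ℝ (Fin 2))

/-- **The positive shear** of the framed torus model `T² × ℝ²`: rotate the first core circle by
the unit normal vector, `((z₁, z₂), w) ↦ ((w/‖w‖ · z₁, z₂), w)` (junk: identity rotation at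
`w = 0`). This is the regluing `ψ_A` of `IsTorusLinkSurgery` for the matrix `shearMatrixPos`
(`exists_angles_iff_shearPos`). [folklore] -/
def shearPos (b : TT) : TT := ((circleMul (unitVector₀ b.2) b.1.1, b.1.2), b.2)

/-- **The negative shear** `((z₁, z₂), w) ↦ ((w̄/‖w‖ · z₁, z₂), w)`, the regluing for
`shearMatrixNeg`. [folklore] -/
def shearNeg (b : TT) : TT := ((circleMul (conjCircle (unitVector₀ b.2)) b.1.1, b.1.2), b.2)

/-- The shear matrix `(θ₁, θ₂, θ₃) ↦ (θ₁ + θ₃, θ₂, θ₃)` of `GL(3, ℤ)` (rows `(1,0,1), (0,1,0),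
(0,0,1)`): multiplicity one, the meridian picks up one longitude. [folklore] -/
def shearMatrixPos : Matrix (Fin 3) (Fin 3) ℤ := !![1, 0, 1; 0, 1, 0; 0, 0, 1]

/-- The shear matrix `(θ₁, θ₂, θ₃) ↦ (θ₁ - θ₃, θ₂, θ₃)`. [folklore] -/
def shearMatrixNeg : Matrix (Fin 3) (Fin 3) ℤ := !![1, 0, -1; 0, 1, 0; 0, 0, 1]

/-- `det = 1`. [folklore] -/
theorem det_shearMatrixPos : shearMatrixPos.det = 1 := by
  simp [shearMatrixPos, Matrix.det_fin_three]

/-- `det = 1`. [folklore] -/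
theorem det_shearMatrixNeg : shearMatrixNeg.det = 1 := by
  simp [shearMatrixNeg, Matrix.det_fin_three]

/-- The three angle rows of `shearMatrixPos`, in the literal cast form of `IsTorusLinkSurgery`.
[folklore] -/
theorem shearMatrixPos_rows (θ₁ θ₂ θ₃ : ℝ) :
    (shearMatrixPos 0 0 : ℝ) * θ₁ + (shearMatrixPos 0 1 : ℝ) * θ₂ + (shearMatrixPos 0 2 : ℝ) * θ₃ =
      θ₁ + θ₃ ∧
    (shearMatrixPos 1 0 : ℝ) * θ₁ + (shearMatrixPos 1 1 : ℝ) * θ₂ + (shearMatrixPos 1 2 : ℝ) * θ₃ =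
      θ₂ ∧
    (shearMatrixPos 2 0 : ℝ) * θ₁ + (shearMatrixPos 2 1 : ℝ) * θ₂ + (shearMatrixPos 2 2 : ℝ) * θ₃ =
      θ₃ := by
  simp [shearMatrixPos]

/-- The three angle rows of `shearMatrixNeg`. [folklore] -/
theorem shearMatrixNeg_rows (θ₁ θ₂ θ₃ : ℝ) :
    (shearMatrixNeg 0 0 : ℝ) * θ₁ + (shearMatrixNeg 0 1 : ℝ) * θ₂ + (shearMatrixNeg 0 2 : ℝ) * θ₃ =
      θ₁ - θ₃ ∧
    (shearMatrixNeg 1 0 : ℝ) * θ₁ + (shearMatrixNeg 1 1 : ℝ) * θ₂ + (shearMatrixNeg 1 2 : ℝ) * θ₃ =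
      θ₂ ∧
    (shearMatrixNeg 2 0 : ℝ) * θ₁ + (shearMatrixNeg 2 1 : ℝ) * θ₂ + (shearMatrixNeg 2 2 : ℝ) * θ₃ =
      θ₃ := by
  simp [shearMatrixNeg, sub_eq_add_neg]

/-- The positive shear in polar form. [folklore] -/
theorem shearPos_polar (θ₁ θ₂ θ₃ : ℝ) {t : ℝ} (ht : 0 < t) :
    shearPos ((circlePoint θ₁, circlePoint θ₂), t • ((circlePoint θ₃ : S¹) : EuclideanSpace ℝ (Fin 2))) =
      ((circlePoint (θ₁ + θ₃), circlePoint θ₂), t • ((circlePoint θ₃ : S¹) : EuclideanSpace ℝ (Fin 2))) := by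
  simp only [shearPos, unitVector₀_smul_coe ht, circleMul_circlePoint, add_comm θ₃ θ₁]

/-- The negative shear in polar form. [folklore] -/
theorem shearNeg_polar (θ₁ θ₂ θ₃ : ℝ) {t : ℝ} (ht : 0 < t) :
    shearNeg ((circlePoint θ₁, circlePoint θ₂), t • ((circlePoint θ₃ : S¹) : EuclideanSpace ℝ (Fin 2))) =
      ((circlePoint (θ₁ - θ₃), circlePoint θ₂), t • ((circlePoint θ₃ : S¹) : EuclideanSpace ℝ (Fin 2))) := by
  simp only [shearNeg, unitVector₀_smul_coe ht, conjCircle_circlePoint, circleMul_circlePoint]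
  congr 2
  ring_nf

/-- **Angle form versus rotation form of the shear regluing (positive sign).** For any map `T₀`
on the framed torus model and any point `p`: the fibre relation of `IsTorusLinkSurgery` with the
matrix `shearMatrixPos` — `b` has polar angles `(θ₁, θ₂, θ₃)` and radius `t > 0`, and
`p = T₀` of the point with angles `(θ₁ + θ₃, θ₂, θ₃)` and the same radius — holds iff `b` is off
the core and `p = T₀ (shearPos b)`. [folklore] -/
theorem exists_angles_iff_shearPos {α : Type*} (T₀ : TT → α) (p : α) (b : TT) :
    (∃ θ₁ θ₂ θ₃ t : ℝ, 0 < t ∧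
      b = ((circlePoint θ₁, circlePoint θ₂), t • ((circlePoint θ₃ : S¹) : EuclideanSpace ℝ (Fin 2))) ∧
      p = T₀ ((circlePoint ((shearMatrixPos 0 0 : ℝ) * θ₁ + (shearMatrixPos 0 1 : ℝ) * θ₂ +
          (shearMatrixPos 0 2 : ℝ) * θ₃), circlePoint ((shearMatrixPos 1 0 : ℝ) * θ₁ +
          (shearMatrixPos 1 1 : ℝ) * θ₂ + (shearMatrixPos 1 2 : ℝ) * θ₃)),
        t • ((circlePoint ((shearMatrixPos 2 0 : ℝ) * θ₁ + (shearMatrixPos 2 1 : ℝ) * θ₂ +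
          (shearMatrixPos 2 2 : ℝ) * θ₃) : S¹) : EuclideanSpace ℝ (Fin 2)))) ↔
    b.2 ≠ 0 ∧ p = T₀ (shearPos b) := by
  constructor
  · rintro ⟨θ₁, θ₂, θ₃, t, ht, rfl, hp⟩
    obtain ⟨r0, r1, r2⟩ := shearMatrixPos_rows θ₁ θ₂ θ₃
    rw [r0, r1, r2] at hp
    exact ⟨smul_ne_zero ht.ne' (ne_zero_of_mem_unit_sphere _), by rw [hp, shearPos_polar _ _ _ ht]⟩
  · rintro ⟨hb, rfl⟩
    obtain ⟨⟨z₁, z₂⟩, w⟩ := b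
    obtain ⟨θ₁, rfl⟩ := circlePoint_surjective z₁
    obtain ⟨θ₂, rfl⟩ := circlePoint_surjective z₂
    obtain ⟨θ₃, -, hw⟩ := exists_eq_smul_circlePoint hb
    have ht : 0 < ‖w‖ := norm_pos_iff.2 hb
    refine ⟨θ₁, θ₂, θ₃, ‖w‖, ht, by rw [← hw], ?_⟩
    obtain ⟨r0, r1, r2⟩ := shearMatrixPos_rows θ₁ θ₂ θ₃
    rw [r0, r1, r2, ← shearPos_polar _ _ _ ht, ← hw]

/-- **Angle form versus rotation form of the shear regluing (negative sign)**, for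
`shearMatrixNeg` and `shearNeg`. [folklore] -/
theorem exists_angles_iff_shearNeg {α : Type*} (T₀ : TT → α) (p : α) (b : TT) :
    (∃ θ₁ θ₂ θ₃ t : ℝ, 0 < t ∧
      b = ((circlePoint θ₁, circlePoint θ₂), t • ((circlePoint θ₃ : S¹) : EuclideanSpace ℝ (Fin 2))) ∧
      p = T₀ ((circlePoint ((shearMatrixNeg 0 0 : ℝ) * θ₁ + (shearMatrixNeg 0 1 : ℝ) * θ₂ +
          (shearMatrixNeg 0 2 : ℝ) * θ₃), circlePoint ((shearMatrixNeg 1 0 : ℝ) * θ₁ +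
          (shearMatrixNeg 1 1 : ℝ) * θ₂ + (shearMatrixNeg 1 2 : ℝ) * θ₃)),
        t • ((circlePoint ((shearMatrixNeg 2 0 : ℝ) * θ₁ + (shearMatrixNeg 2 1 : ℝ) * θ₂ +
          (shearMatrixNeg 2 2 : ℝ) * θ₃) : S¹) : EuclideanSpace ℝ (Fin 2)))) ↔
    b.2 ≠ 0 ∧ p = T₀ (shearNeg b) := by
  constructor
  · rintro ⟨θ₁, θ₂, θ₃, t, ht, rfl, hp⟩
    obtain ⟨r0, r1, r2⟩ := shearMatrixNeg_rows θ₁ θ₂ θ₃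
    rw [r0, r1, r2] at hp
    exact ⟨smul_ne_zero ht.ne' (ne_zero_of_mem_unit_sphere _), by rw [hp, shearNeg_polar _ _ _ ht]⟩
  · rintro ⟨hb, rfl⟩
    obtain ⟨⟨z₁, z₂⟩, w⟩ := b
    obtain ⟨θ₁, rfl⟩ := circlePoint_surjective z₁
    obtain ⟨θ₂, rfl⟩ := circlePoint_surjective z₂
    obtain ⟨θ₃, -, hw⟩ := exists_eq_smul_circlePoint hb
    have ht : 0 < ‖w‖ := norm_pos_iff.2 hb
    refine ⟨θ₁, θ₂, θ₃, ‖w‖, ht, by rw [← hw], ?_⟩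
    obtain ⟨r0, r1, r2⟩ := shearMatrixNeg_rows θ₁ θ₂ θ₃
    rw [r0, r1, r2, ← shearNeg_polar _ _ _ ht, ← hw]

end Shear

end Literature.Topology.FourManifolds
end
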